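import Literature.Probability.NegativeDependence.RayleighMeasures
import Literature.Probability.NegativeDependence.DeterminantalStochasticDomination
import HarnessLib

/-!
# Inversion `z_1⋯z_n f(1/z)` of a measure: Rayleigh and strongly Rayleigh are preserved, `⊴` is reversed,
# and the second display of Prop. 4.15 (Borcea–Brändén–Liggett, Prop. 2.1 (5), Prop. 3.1, Prop. 4.15)

J. Borcea, P. Brändén, T. M. Liggett, *Negative dependence and the geometry of polynomials*, J. Amer. Math.
Soc. 22 (2009) 521–567 (arXiv:0707.2340, held `paper:arxiv-0707.2340`; numbering of the arXiv version).
Verbatim: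

> (§2.1) **Proposition 2.1.** If `f(z_1,…,z_n)` is Rayleigh then so are the following polynomials: […]
> (5) the "inversion" of `f`, i.e., the polynomial `z_1⋯z_n f(z_1^{-1},…,z_n^{-1})`; […]
>
> (§3) **Proposition 3.1.** Let `𝓗_n(ℝ)` be the set of all real stable polynomials in `n` variables. […]
> (2) If `f ∈ 𝓗_n(ℝ)` has degree `d_j` in variable `z_j`, `j ∈ [n]`, then […]
> `z_1^{d_1}⋯z_n^{d_n} f(λ_1 z_1^{-1},…,λ_n z_n^{-1}) ∈ 𝓗_n(ℝ)` if `±(λ_1,…,λ_n) ∈ ℝ_+^n`; […]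
>
> (§4.3.1) **Proposition 4.15.** Let `A` and `B` be positive semi-definite `n × n` matrices such that `A ≤ B`
> and set `Z = diag(z_1,…,z_n)`. Then
> `det(I+AZ)/det(I+A) ⊴ det(I+BZ)/det(I+B)` and `det(B+Z)/det(B+I) ⊴ det(A+Z)/det(A+I)`. […]
> *Proof.* We just prove the first inequality. The second inequality then follows upon considering the
> operation `det(I+MZ) := f_M(z_1,…,z_n) ↦ z_1⋯z_n f_M(z_1^{-1},…,z_n^{-1})` with `M = A` and `M = B`,
> respectively, which preserves the set of stable polynomials with non-negative coefficients (Proposition 3.1)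
> and obviously reverses the partial order `⊴` (Theorem 4.11).
>
> (§4.3.1, Thm. 4.11 / Def. 4.1) `f ≪ g` iff `g + z_{n+1} f` is real stable; `μ ⊴′ ν` if there is a chain of
> strongly Rayleigh probability measures `g_{μ_0} ≪ g_{μ_1} ≪ ⋯ ≪ g_{μ_ℓ}`; `⊴` is the closure of `⊴′`.

## Transposition

* Weights `μ : Finset σ → ℝ` on `2^σ` with generating polynomial `g_μ = multiAffine μ = Σ_S μ(S) z^S`, as in the
  sibling files (`StableOrZero`, `IsRayleigh`, `derivWeight`, `pinIn`/`pinOut`, `pencilWeight`, `SRStep`/`SRLe'`/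
  `SRLe` = `⊴′`/`⊴`, `minorWeight`/`minorLaw`, `BorceaBrandenLiggett_prop_4_15`). For multi-affine `g_μ` the
  inversion `z^{[n]} g_μ(1/z)` is the generating polynomial of the **inverted weight**
  `invWeight μ (S) = μ(σ ∖ S)` (`sum_invWeight_mul_prod`).
* Prop. 3.1 (2), inversion with `λ = (1,…,1)` and all `d_j = 1`, is proved for multi-affine real polynomials in the
  tree's "stable or zero" function form (`StableOrZero.invWeight`): for `z ∈ ℋ^n` one has `1/z̄_j ∈ ℋ`, and
  `g_μ(1/z) = conj(g_μ(1/z̄)) ≠ 0` because `g_μ` has real coefficients.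
* Prop. 2.1 (5) (`isRayleigh_invWeight`): the Rayleigh difference of a multi-affine `g` is
  `Δ_{ij}(g) = b c - a d` for `g = a z_i z_j + b z_i + c z_j + d` (`eval_rayleighDiff_multiAffine_eq_of_ne`, in the
  weight vocabulary `a = g_{∂_i∂_j μ}`, `b = g_{∂_i μ|z_j=0}`, `c = g_{∂_j μ|z_i=0}`, `d = g_{μ|z_i=z_j=0}`), and
  inversion exchanges `∂_i` with `z_i := 0` (`invWeight_pinIn`, `invWeight_pinOut`), whence
  `Δ_{ij}(z^{[n]} g(1/z))(x) = (x^{[n]∖{i,j}})² Δ_{ij}(g)(1/x) ≥ 0` on the open orthant.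
* "Obviously reverses the partial order `⊴` (Theorem 4.11)": the inversion (in all `n+1` variables) of
  `g_ν + z_{n+1} g_μ` is `g_{inv μ} + z_{n+1} g_{inv ν}` (`invWeight_pencilWeight`), so `g_μ ≪ g_ν` implies
  `g_{inv ν} ≪ g_{inv μ}` (`IsProperPosition.invWeight`); chains and limits are reversed accordingly
  (`SRStep.reverse`, `SRLe'.reverse`, `SRLe.reverse`; inversion keeps mass and is continuous).
* Prop. 4.15, second display: the law `S ↦ det M[σ∖S]/det(I+M)` (`cominorLaw M = invWeight (minorLaw M)`) has
  generating polynomial `det(M+Z)/det(M+I)` (`sum_invWeight_minorWeight_mul_prod`: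
  `Σ_S det M[σ∖S] z^S = det(diag(z) + M)`), and `cominorLaw B ⊴′ cominorLaw A` for `0 ≤ A ≤ B`
  (`BorceaBrandenLiggett_prop_4_15_second`), exactly by the printed reduction to the first display (tree).

## Contents

* §1 `invWeight`, `mass_invWeight`, `sum_compl_mul_prod`, `sum_invWeight_mul_prod`, `eval_multiAffine_invWeight`,
  `invWeight_pinIn`, `invWeight_pinOut`, `invWeight_pencilWeight`.
* §2 Prop. 3.1 (2) (inversion): `sum_invWeight_mul_prod_ne_zero`, **`StableOrZero.invWeight`**.
* §3 Prop. 2.1 (5): `eval_rayleighDiff_multiAffine_eq_of_ne` (`Δ = bc - ad`), **`isRayleigh_invWeight`**.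
* §4 `IsProperPosition.invWeight`, `SRStep.reverse`, `SRLe'.reverse`, `SRLe.reverse` (inversion reverses `⊴′`, `⊴`).
* §5 `cominorLaw`, `sum_invWeight_minorWeight_mul_prod` (`det(diag z + M)`),
  **`BorceaBrandenLiggett_prop_4_15_second`** (`⊴′`), `…_srLe` (`⊴`), `stochDom_cominorLaw`, `ex_cominorLaw_le`.

## References

* [BorceaBrandenLiggett2007] J. Borcea, P. Brändén, T. M. Liggett, Negative dependence and the geometry of
  polynomials, J. Amer. Math. Soc. 22 (2009), 521–567; arXiv:0707.2340 — §2.1 Prop. 2.1 (5), §3 Prop. 3.1 (2),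
  §4.3.1 Thm. 4.11, Def. 4.1, Prop. 4.12, Prop. 4.15.
* [BorceaBranden2009] J. Borcea, P. Brändén, The Lee–Yang and Pólya–Schur programs I, Invent. Math. 177 (2009)
  (proper position, Lemma 1.7).
-/

noncomputable section

open Finset MvPolynomial Matrix Filter
open Literature.Combinatorics.Sahi2008
open Literature.Combinatorics.StablePolynomials
open Literature.Probability.MarkovChains (StochDom)
open scoped ComplexOrder Topology ComplexConjugate

namespace Literature.Probability.NegativeDependence

variable {σ : Type*} [Fintype σ] [DecidableEq σ]

/-! ## §1 The inverted weight -/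

section InvWeight

/-- **Inversion** of a weight on `2^σ`: `S ↦ μ(σ ∖ S)`; its generating polynomial is the "inversion"
`z_1⋯z_n g_μ(z_1^{-1},…,z_n^{-1})` of the (multi-affine) generating polynomial `g_μ` (BBL Prop. 2.1 (5);
`sum_invWeight_mul_prod`). [cite: BorceaBrandenLiggett2007, §2.1 Prop. 2.1 (5) ("the 'inversion' of `f`")] -/
def invWeight (μ : Finset σ → ℝ) : Finset σ → ℝ := fun S => μ Sᶜ

/-- Unfolding `invWeight`. [cite: BorceaBrandenLiggett2007, §2.1 Prop. 2.1 (5)] -/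
theorem invWeight_apply (μ : Finset σ → ℝ) (S : Finset σ) : invWeight μ S = μ Sᶜ := rfl

/-- Inversion is an involution. [cite: BorceaBrandenLiggett2007, §2.1 Prop. 2.1 (5)] -/
@[simp] theorem invWeight_invWeight (μ : Finset σ → ℝ) : invWeight (invWeight μ) = μ := by
  funext S
  rw [invWeight_apply, invWeight_apply, compl_compl]

/-- Inversion of the zero weight. [cite: BorceaBrandenLiggett2007, §2.1 Prop. 2.1 (5)] -/
@[simp] theorem invWeight_zero : invWeight (0 : Finset σ → ℝ) = 0 := rfl

/-- Inversion keeps nonnegativity. [cite: BorceaBrandenLiggett2007, §2.1 Prop. 2.1 (5)] -/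
theorem invWeight_nonneg {μ : Finset σ → ℝ} (h0 : ∀ S, 0 ≤ μ S) (S : Finset σ) : 0 ≤ invWeight μ S := h0 _

/-- Inversion keeps the total mass. [cite: BorceaBrandenLiggett2007, §2.1 Prop. 2.1 (5)] -/
theorem mass_invWeight (μ : Finset σ → ℝ) : mass (invWeight μ) = mass μ :=
  Fintype.sum_bijective _ (Function.Involutive.bijective compl_compl) _ _ fun _ => rfl

/-- Inversion as a map of weights is continuous (a coordinate permutation).
[cite: BorceaBrandenLiggett2007, §4.3.1 Def. 4.1 ("it does not matter what notion of limit we use")] -/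
theorem continuous_invWeight : Continuous (invWeight : (Finset σ → ℝ) → Finset σ → ℝ) :=
  continuous_pi fun S => continuous_apply Sᶜ

/-- **`Σ_S c(σ∖S) z^S = z^{[n]} Σ_T c(T) z^{-T}`** over a field, for `z` with non-zero coordinates.
[cite: BorceaBrandenLiggett2007, §2.1 Prop. 2.1 (5) ("`z_1⋯z_n f(z_1^{-1},…,z_n^{-1})`")] -/
theorem sum_compl_mul_prod {K : Type*} [Field K] (c : Finset σ → K) {z : σ → K} (hz : ∀ i, z i ≠ 0) :
    (∑ S : Finset σ, c Sᶜ * ∏ i ∈ S, z i) = (∏ i, z i) * ∑ T : Finset σ, c T * ∏ i ∈ T, (z i)⁻¹ := by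
  have h1 : (∑ S : Finset σ, c Sᶜ * ∏ i ∈ S, z i) = ∑ T : Finset σ, c T * ∏ i ∈ Tᶜ, z i :=
    Fintype.sum_bijective (fun S : Finset σ => Sᶜ) (Function.Involutive.bijective compl_compl) _ _ fun S => by
      simp only [compl_compl]
  rw [h1, Finset.mul_sum]
  refine Finset.sum_congr rfl fun T _ => ?_
  have h2 : (∏ i ∈ T, z i) * ∏ i ∈ Tᶜ, z i = ∏ i, z i := Finset.prod_mul_prod_compl T z
  have hT : (∏ i ∈ T, z i) ≠ 0 := Finset.prod_ne_zero_iff.2 fun i _ => hz i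
  rw [Finset.prod_inv_distrib, ← h2]
  field_simp

/-- **The generating polynomial of the inverted weight is the inversion of `g_μ`** (function form over `ℂ`):
`Σ_S μ(σ∖S) z^S = z_1⋯z_n · g_μ(1/z_1,…,1/z_n)`. [cite: BorceaBrandenLiggett2007, §2.1 Prop. 2.1 (5)] -/
theorem sum_invWeight_mul_prod (μ : Finset σ → ℝ) {z : σ → ℂ} (hz : ∀ i, z i ≠ 0) :
    (∑ S : Finset σ, (invWeight μ S : ℂ) * ∏ i ∈ S, z i) =
      (∏ i, z i) * ∑ T : Finset σ, (μ T : ℂ) * ∏ i ∈ T, (z i)⁻¹ :=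
  sum_compl_mul_prod (fun S => (μ S : ℂ)) hz

/-- The same over `ℝ` for the tree's `multiAffine`: `g_{inv μ}(x) = x^{[n]} g_μ(1/x)`.
[cite: BorceaBrandenLiggett2007, §2.1 Prop. 2.1 (5)] -/
theorem eval_multiAffine_invWeight (μ : Finset σ → ℝ) {x : σ → ℝ} (hx : ∀ i, x i ≠ 0) :
    MvPolynomial.eval x (multiAffine (invWeight μ)) =
      (∏ i, x i) * MvPolynomial.eval (fun i => (x i)⁻¹) (multiAffine μ) := by
  rw [eval_multiAffine, eval_multiAffine]
  exact sum_compl_mul_prod μ hx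

/-- **Inversion exchanges `z_i := 0` with `∂_i`**: the inversion of `μ|_{i ∈ S}` is `(inv μ)|_{i ∉ S}`.
[cite: BorceaBrandenLiggett2007, §2.1 Prop. 2.1 (5), §2.1 (iii)] -/
theorem invWeight_pinIn (i : σ) (μ : Finset σ → ℝ) : invWeight (pinIn i μ) = pinOut i (invWeight μ) := by
  funext S
  simp only [invWeight_apply, pinIn_apply, pinOut_apply, Finset.mem_compl]
  by_cases h : i ∈ S <;> simp [h]

/-- Dually, the inversion of `μ|_{i ∉ S}` is `(inv μ)|_{i ∈ S}`. [cite: BorceaBrandenLiggett2007, §2.1 Prop. 2.1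
(5), §2.1 (iii)] -/
theorem invWeight_pinOut (i : σ) (μ : Finset σ → ℝ) : invWeight (pinOut i μ) = pinIn i (invWeight μ) := by
  funext S
  simp only [invWeight_apply, pinIn_apply, pinOut_apply, Finset.mem_compl]
  by_cases h : i ∈ S <;> simp [h]

omit [Fintype σ] in
/-- **Inversion of the pencil**: inverting `g_ν + z_{n+1} g_μ` in all `n+1` variables gives
`g_{inv μ} + z_{n+1} g_{inv ν}`. [cite: BorceaBrandenLiggett2007, §4.3.1 proof of Prop. 4.15 ("obviously reverses
the partial order `⊴` (Theorem 4.11)")] -/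
theorem invWeight_pencilWeight [Fintype σ] (μ ν : Finset σ → ℝ) :
    invWeight (pencilWeight μ ν) = pencilWeight (invWeight ν) (invWeight μ) := by
  funext U
  have hc : Finset.eraseNone Uᶜ = (Finset.eraseNone U)ᶜ := by
    ext i
    simp
  simp only [invWeight_apply, pencilWeight_apply, Finset.mem_compl, hc]
  by_cases h : none ∈ U <;> simp [h]

end InvWeight

/-! ## §2 Proposition 3.1 (2): inversion preserves real stability (multi-affine case) -/

section Stable

/-- **Prop. 3.1 (2), inversion, for multi-affine real polynomials in function form**: if
`Σ_S γ(S) z^S ≠ 0` on `ℋ^τ` then `Σ_S γ(τ∖S) z^S ≠ 0` on `ℋ^τ` — because `1/z̄_j ∈ ℋ` and the coefficients are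
real. [cite: BorceaBrandenLiggett2007, §3 Prop. 3.1 (2) (`z^{d} f(λ z^{-1})`, `λ = (1,…,1)`)] -/
theorem sum_invWeight_mul_prod_ne_zero {τ : Type*} [Fintype τ] [DecidableEq τ] {γ : Finset τ → ℝ}
    (h : ∀ z : τ → ℂ, (∀ i, 0 < (z i).im) → (∑ S : Finset τ, (γ S : ℂ) * ∏ i ∈ S, z i) ≠ 0)
    {z : τ → ℂ} (hz : ∀ i, 0 < (z i).im) :
    (∑ S : Finset τ, (invWeight γ S : ℂ) * ∏ i ∈ S, z i) ≠ 0 := by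
  have hz0 : ∀ i, z i ≠ 0 := fun i h0 => (hz i).ne' (by rw [h0, Complex.zero_im])
  rw [sum_invWeight_mul_prod γ hz0]
  refine mul_ne_zero (Finset.prod_ne_zero_iff.2 fun i _ => hz0 i) ?_
  set w : τ → ℂ := fun i => conj ((z i)⁻¹) with hw
  have hwim : ∀ i, 0 < (w i).im := by
    intro i
    simp only [hw, Complex.conj_im, Complex.inv_im, neg_div, neg_neg]
    exact div_pos (hz i) (Complex.normSq_pos.2 (hz0 i))
  have hsum : (∑ T : Finset τ, (γ T : ℂ) * ∏ i ∈ T, (z i)⁻¹) = conj (∑ T : Finset τ, (γ T : ℂ) * ∏ i ∈ T, w i) := by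
    rw [map_sum]
    refine Finset.sum_congr rfl fun T _ => ?_
    rw [map_mul, Complex.conj_ofReal, map_prod]
    simp only [hw, Complex.conj_conj]
  rw [hsum, Ne, map_eq_zero_iff _ (RingHom.injective _)]
  exact h w hwim

/-- **Inversion preserves "stable or zero"** (BBL Prop. 3.1 (2) for multi-affine real stable polynomials: the
inversion `z^{[n]} g_μ(1/z)` of a real stable `g_μ` is real stable). [cite: BorceaBrandenLiggett2007, §3 Prop. 3.1
(2); §4.3.1 proof of Prop. 4.15 ("preserves the set of stable polynomials with non-negative coefficients")] -/
theorem StableOrZero.invWeight {μ : Finset σ → ℝ} (h : StableOrZero μ) : StableOrZero (invWeight μ) := by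
  rcases h with h0 | h
  · exact Or.inl fun S => h0 _
  · exact Or.inr fun z hz => sum_invWeight_mul_prod_ne_zero h hz

end Stable

/-! ## §3 Proposition 2.1 (5): inversion preserves the Rayleigh property -/

section Rayleigh

omit [Fintype σ] in
/-- Deletions commute. [cite: BorceaBrandenLiggett2007, §2.1 (iii)] -/
theorem pinOut_pinOut_comm (e f : σ) (μ : Finset σ → ℝ) : pinOut e (pinOut f μ) = pinOut f (pinOut e μ) := by
  funext S
  simp only [pinOut_apply]
  split_ifs <;> rfl

/-- **`Δ_{ij}(g) = bc - ad` for multi-affine `g = a z_i z_j + b z_i + c z_j + d`** (`i ≠ j`), in weights: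
`Δ_{ij}(g_μ)(x) = g_{(∂_iμ)|z_j=0}(x) g_{(∂_jμ)|z_i=0}(x) - g_{∂_i∂_jμ}(x) g_{μ|z_i=z_j=0}(x)`.
[cite: BorceaBrandenLiggett2007, §2.1 Def. 2.5; §4 Thm. 4.1] -/
theorem eval_rayleighDiff_multiAffine_eq_of_ne (μ : Finset σ → ℝ) {i j : σ} (hij : i ≠ j) (x : σ → ℝ) :
    MvPolynomial.eval x (rayleighDiff i j (multiAffine μ)) =
      MvPolynomial.eval x (multiAffine (pinOut j (derivWeight i μ))) *
          MvPolynomial.eval x (multiAffine (pinOut i (derivWeight j μ))) -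
        MvPolynomial.eval x (multiAffine (derivWeight i (derivWeight j μ))) *
          MvPolynomial.eval x (multiAffine (pinOut i (pinOut j μ))) := by
  rw [eval_rayleighDiff_multiAffine]
  have h1 := eval_multiAffine_split (derivWeight i μ) j x
  have h2 := eval_multiAffine_split (derivWeight j μ) i x
  have h3 := eval_multiAffine_split μ i x
  have h4 := eval_multiAffine_split (pinOut i μ) j x
  rw [derivWeight_pinOut_of_ne hij.symm, pinOut_pinOut_comm j i] at h4
  rw [derivWeight_comm j i] at h1
  rw [h3, h1, h2, h4]
  ring

/-- `g_{∂_i ρ}(x) = x_i^{-1} g_{ρ|_{i ∈ S}}(x)` for `x_i ≠ 0`. [cite: BorceaBrandenLiggett2007, §2.1 (iii)] -/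
theorem eval_multiAffine_derivWeight_eq_inv_mul (ρ : Finset σ → ℝ) (i : σ) {x : σ → ℝ} (hx : x i ≠ 0) :
    MvPolynomial.eval x (multiAffine (derivWeight i ρ)) = (x i)⁻¹ * MvPolynomial.eval x (multiAffine (pinIn i ρ)) := by
  rw [eval_multiAffine_pinIn, ← mul_assoc, inv_mul_cancel₀ hx, one_mul]

/-- **Borcea–Brändén–Liggett, Prop. 2.1 (5): the inversion of a Rayleigh polynomial is Rayleigh**
(`Δ_{ij}(z^{[n]} g(1/z))(x) = (x^{[n]∖{i,j}})² Δ_{ij}(g)(1/x)` on the open orthant).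
[cite: BorceaBrandenLiggett2007, §2.1 Prop. 2.1 (5)] -/
theorem isRayleigh_invWeight {μ : Finset σ → ℝ} (h : IsRayleigh μ) : IsRayleigh (invWeight μ) := by
  intro x hx i j
  have hx0 : ∀ k, x k ≠ 0 := fun k => (hx k).ne'
  set y : σ → ℝ := fun k => (x k)⁻¹ with hy
  have hy0 : ∀ k, 0 < y k := fun k => inv_pos.2 (hx k)
  rcases eq_or_ne i j with rfl | hij
  · rw [eval_rayleighDiff_multiAffine, derivWeight_derivWeight_self]
    have : multiAffine (0 : Finset σ → ℝ) = 0 := by simp [multiAffine]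
    rw [this, map_zero, zero_mul, sub_zero]
    exact mul_self_nonneg _
  have key := h y hy0 i j
  rw [eval_rayleighDiff_multiAffine_eq_of_ne μ hij] at key
  rw [eval_rayleighDiff_multiAffine_eq_of_ne _ hij]
  -- the four coefficients of the inverted weight in terms of those of `μ` at `y = 1/x`
  set P : ℝ := ∏ k, x k with hP
  have hb : MvPolynomial.eval x (multiAffine (pinOut j (derivWeight i (invWeight μ)))) =
      (x i)⁻¹ * (x j)⁻¹ * P * MvPolynomial.eval y (multiAffine (pinOut i (derivWeight j μ))) := by
    rw [← derivWeight_pinOut_of_ne hij, eval_multiAffine_derivWeight_eq_inv_mul _ i (hx0 i), ← invWeight_pinIn,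
      ← invWeight_pinOut, eval_multiAffine_invWeight _ hx0, ← pinIn_pinOut_comm, eval_multiAffine_pinIn,
      derivWeight_pinOut_of_ne hij.symm]
    simp only [hy, hP]
    ring
  have hc : MvPolynomial.eval x (multiAffine (pinOut i (derivWeight j (invWeight μ)))) =
      (x i)⁻¹ * (x j)⁻¹ * P * MvPolynomial.eval y (multiAffine (pinOut j (derivWeight i μ))) := by
    rw [← derivWeight_pinOut_of_ne hij.symm, eval_multiAffine_derivWeight_eq_inv_mul _ j (hx0 j), ← invWeight_pinIn,
      ← invWeight_pinOut, eval_multiAffine_invWeight _ hx0, ← pinIn_pinOut_comm, eval_multiAffine_pinIn,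
      derivWeight_pinOut_of_ne hij]
    simp only [hy, hP]
    ring
  have ha : MvPolynomial.eval x (multiAffine (derivWeight i (derivWeight j (invWeight μ)))) =
      (x i)⁻¹ * (x j)⁻¹ * P * MvPolynomial.eval y (multiAffine (pinOut i (pinOut j μ))) := by
    rw [eval_multiAffine_derivWeight_eq_inv_mul _ i (hx0 i), ← derivWeight_pinIn_of_ne hij.symm,
      eval_multiAffine_derivWeight_eq_inv_mul _ j (hx0 j), ← invWeight_pinOut, ← invWeight_pinOut,
      eval_multiAffine_invWeight _ hx0, pinOut_pinOut_comm]
    simp only [hy, hP]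
    ring
  have hd : MvPolynomial.eval x (multiAffine (pinOut i (pinOut j (invWeight μ)))) =
      (x i)⁻¹ * (x j)⁻¹ * P * MvPolynomial.eval y (multiAffine (derivWeight i (derivWeight j μ))) := by
    rw [← invWeight_pinIn, ← invWeight_pinIn, eval_multiAffine_invWeight _ hx0, eval_multiAffine_pinIn,
      derivWeight_pinIn_of_ne hij, eval_multiAffine_pinIn, derivWeight_comm j i μ]
    simp only [hy, hP]
    field_simp
  rw [hb, hc, ha, hd]
  have hK : 0 ≤ ((x i)⁻¹ * (x j)⁻¹ * P) ^ 2 := sq_nonneg _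
  nlinarith [mul_nonneg hK key]

end Rayleigh

/-! ## §4 Inversion reverses proper position, `⊴′` and `⊴` -/

section Reverse

/-- **"Inversion obviously reverses `⊴` (Theorem 4.11)"**, one link: if `g_μ ≪ g_ν` then
`g_{inv ν} ≪ g_{inv μ}` — invert `g_ν + z_{n+1} g_μ` in all `n+1` variables. [cite: BorceaBrandenLiggett2007,
§4.3.1 proof of Prop. 4.15; Thm. 4.11] -/
theorem IsProperPosition.invWeight {μ ν : Finset σ → ℝ} (h : IsProperPosition (multiAffine μ) (multiAffine ν)) :
    IsProperPosition (multiAffine (invWeight ν)) (multiAffine (invWeight μ)) := by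
  rw [isProperPosition_iff_isRealStable_add_X_mul]
  have hfun : ∀ z : Option σ → ℂ, (∀ i, 0 < (z i).im) →
      (∑ U : Finset (Option σ), (pencilWeight μ ν U : ℂ) * ∏ u ∈ U, z u) ≠ 0 := by
    intro z hz
    rw [sum_pencilWeight_mul_prod]
    exact (isProperPosition_iff_isRealStable_add_X_mul _ _).1 h z hz
  intro z hz
  rw [← sum_pencilWeight_mul_prod, ← invWeight_pencilWeight]
  exact sum_invWeight_mul_prod_ne_zero hfun hz

/-- One `⊴′`-link is reversed by inversion. [cite: BorceaBrandenLiggett2007, §4.3.1 proof of Prop. 4.15] -/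
theorem SRStep.reverse {μ ν : Finset σ → ℝ} (h : SRStep μ ν) : SRStep (invWeight ν) (invWeight μ) :=
  ⟨⟨invWeight_nonneg h.2.1.1, by rw [mass_invWeight]; exact h.2.1.2⟩,
    ⟨invWeight_nonneg h.1.1, by rw [mass_invWeight]; exact h.1.2⟩, IsProperPosition.invWeight h.2.2⟩

omit [DecidableEq σ] in
/-- The far end of a `⊴′`-chain is again a strongly Rayleigh probability weight. [cite: BorceaBrandenLiggett2007,
§4.3.1 Def. 4.1] -/
theorem SRLe'.right {μ ν : Finset σ → ℝ} (h : SRLe' μ ν) : (∀ S, 0 ≤ ν S) ∧ mass ν = 1 ∧ StableOrZero ν := by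
  obtain ⟨hμ, hchain⟩ := h
  induction hchain with
  | refl => exact hμ
  | tail _ hbc _ =>
    refine ⟨hbc.2.1.1, hbc.2.1.2, ?_⟩
    rw [stableOrZero_iff]
    exact hbc.2.2.eq_zero_or_isRealStable_right

/-- **Inversion reverses `⊴′`.** [cite: BorceaBrandenLiggett2007, §4.3.1 proof of Prop. 4.15 ("obviously reverses
the partial order")] -/
theorem SRLe'.reverse {μ ν : Finset σ → ℝ} (h : SRLe' μ ν) : SRLe' (invWeight ν) (invWeight μ) := by
  obtain ⟨hν0, hν1, hνs⟩ := h.right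
  refine ⟨⟨invWeight_nonneg hν0, by rw [mass_invWeight]; exact hν1, hνs.invWeight⟩, ?_⟩
  have key : ∀ {b : Finset σ → ℝ}, Relation.ReflTransGen SRStep μ b →
      Relation.ReflTransGen SRStep (invWeight b) (invWeight μ) := by
    intro b hb
    induction hb with
    | refl => exact Relation.ReflTransGen.refl
    | tail _ hbc ih => exact Relation.ReflTransGen.head hbc.reverse ih
  exact key h.2

omit [DecidableEq σ] in
/-- **Inversion reverses `⊴`** (limits pass through the continuous, mass-preserving inversion).
[cite: BorceaBrandenLiggett2007, §4.3.1 proof of Prop. 4.15; Def. 4.1] -/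
theorem SRLe.reverse [DecidableEq σ] {μ ν : Finset σ → ℝ} (h : SRLe μ ν) : SRLe (invWeight ν) (invWeight μ) := by
  obtain ⟨μs, νs, hμ, hν, hj⟩ := h
  exact ⟨fun j => invWeight (νs j), fun j => invWeight (μs j), (continuous_invWeight.tendsto ν).comp hν,
    (continuous_invWeight.tendsto μ).comp hμ, fun j => (hj j).reverse⟩

end Reverse

/-! ## §5 Proposition 4.15, second display -/

section Prop415

/-- **The complementary-minor law** `S ↦ det M[σ∖S] / det(I+M)`: the probability measure with generating
polynomial `det(M+Z)/det(M+I)` (`sum_invWeight_minorWeight_mul_prod`), i.e. the inversion of the law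
`det(I+MZ)/det(I+M)` (`minorLaw M`). [cite: BorceaBrandenLiggett2007, §4.3.1 Prop. 4.15 ("`det(B+Z)/det(B+I)`")] -/
def cominorLaw (M : Matrix σ σ ℝ) : Finset σ → ℝ := invWeight (minorLaw M)

/-- Unfolding `cominorLaw`. [cite: BorceaBrandenLiggett2007, §4.3.1 Prop. 4.15] -/
theorem cominorLaw_apply (M : Matrix σ σ ℝ) (S : Finset σ) :
    cominorLaw M S = minorWeight M Sᶜ / mass (minorWeight M) := by
  rw [cominorLaw, invWeight_apply, minorLaw_apply]

/-- **`Σ_S det M[σ∖S] z^S = det(diag(z) + M)`** — the generating polynomial of the complementary-minor weight is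
`det(M + Z)` (for `z` with non-zero coordinates via `z^{[n]} det(I + M Z^{-1})`, then by density).
[cite: BorceaBrandenLiggett2007, §4.3.1 Prop. 4.15 and its proof ("`f_M ↦ z_1⋯z_n f_M(z_1^{-1},…,z_n^{-1})`")] -/
theorem sum_invWeight_minorWeight_mul_prod (M : Matrix σ σ ℝ) (z : σ → ℂ) :
    (∑ S : Finset σ, (invWeight (minorWeight M) S : ℂ) * ∏ i ∈ S, z i) =
      (diagonal z + M.map (algebraMap ℝ ℂ)).det := by
  -- on the dense set of `z` with non-zero coordinates
  have key : ∀ z : σ → ℂ, (∀ i, z i ≠ 0) →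
      (∑ S : Finset σ, (invWeight (minorWeight M) S : ℂ) * ∏ i ∈ S, z i) = (diagonal z + M.map (algebraMap ℝ ℂ)).det := by
    intro z hz
    rw [sum_invWeight_mul_prod _ hz, sum_minorWeight_mul_prod, ← det_diagonal, ← det_mul, Matrix.mul_add, mul_one,
      ← Matrix.mul_assoc, diagonal_mul_diagonal]
    congr 2
    convert Matrix.one_mul (M.map (algebraMap ℝ ℂ)) using 2
    rw [← diagonal_one]
    congr 1
    funext i
    exact mul_inv_cancel₀ (hz i)
  have hcL : Continuous fun z : σ → ℂ => ∑ S : Finset σ, (invWeight (minorWeight M) S : ℂ) * ∏ i ∈ S, z i :=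
    continuous_finsetSum _ fun S _ => continuous_const.mul (continuous_finsetProd _ fun i _ => continuous_apply i)
  have hcR : Continuous fun z : σ → ℂ => (diagonal z + M.map (algebraMap ℝ ℂ)).det :=
    (continuous_id.matrix_diagonal.add continuous_const).matrix_det
  have hdense : Dense {z : σ → ℂ | ∀ i, z i ≠ 0} := by
    have hset : {z : σ → ℂ | ∀ i, z i ≠ 0} = Set.pi Set.univ fun _ => ({0}ᶜ : Set ℂ) := by
      ext z
      simp [Set.mem_pi]
    rw [hset]
    exact dense_pi Set.univ fun i _ => dense_compl_singleton 0
  exact congrFun (Continuous.ext_on hdense hcL hcR fun z hz => key z hz) z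

/-- The generating polynomial of `cominorLaw M` is `det(diag z + M)/det(I + M)`. [cite: BorceaBrandenLiggett2007,
§4.3.1 Prop. 4.15 ("`det(B+Z)/det(B+I)`")] -/
theorem sum_cominorLaw_mul_prod (M : Matrix σ σ ℝ) (z : σ → ℂ) :
    (∑ S : Finset σ, (cominorLaw M S : ℂ) * ∏ i ∈ S, z i) =
      (diagonal z + M.map (algebraMap ℝ ℂ)).det / (mass (minorWeight M) : ℂ) := by
  rw [← sum_invWeight_minorWeight_mul_prod, Finset.sum_div]
  refine Finset.sum_congr rfl fun S _ => ?_
  rw [cominorLaw_apply, invWeight_apply, Complex.ofReal_div]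
  ring

/-- `det(I + M) = det(M + I)`: the normalizations of the two displays agree (`mass` of the minor weight).
[cite: BorceaBrandenLiggett2007, §4.3.1 Prop. 4.15] -/
theorem mass_invWeight_minorWeight (M : Matrix σ σ ℝ) : mass (invWeight (minorWeight M)) = mass (minorWeight M) :=
  mass_invWeight _

variable {A B : Matrix σ σ ℝ}

/-- **Borcea–Brändén–Liggett, Proposition 4.15 (second display).** "Let `A` and `B` be positive semi-definite
`n × n` matrices such that `A ≤ B` […]. Then `det(B+Z)/det(B+I) ⊴ det(A+Z)/det(A+I)`": the complementary-minor
laws satisfy `cominorLaw B ⊴′ cominorLaw A`. Proof as printed: apply the inversion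
`f_M ↦ z_1⋯z_n f_M(1/z)` (`M = A, B`) to the first display (tree `BorceaBrandenLiggett_prop_4_15`); it preserves
strongly Rayleigh probability measures (Prop. 3.1) and reverses `⊴′` (`SRLe'.reverse`).
[cite: BorceaBrandenLiggett2007, §4.3.1 Prop. 4.15 (second display) and its proof] -/
theorem BorceaBrandenLiggett_prop_4_15_second (hA : A.PosSemidef) (hAB : (B - A).PosSemidef) :
    SRLe' (cominorLaw B) (cominorLaw A) :=
  (BorceaBrandenLiggett_prop_4_15 hA hAB).reverse

/-- Proposition 4.15, second display, in the closed order `⊴`. [cite: BorceaBrandenLiggett2007, §4.3.1 Prop. 4.15] -/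
theorem BorceaBrandenLiggett_prop_4_15_second_srLe (hA : A.PosSemidef) (hAB : (B - A).PosSemidef) :
    SRLe (cominorLaw B) (cominorLaw A) :=
  (BorceaBrandenLiggett_prop_4_15_second hA hAB).srLe

/-- **Second display with Proposition 4.12**: `cominorLaw B ≼ cominorLaw A` (stochastic domination, tree `StochDom`).
[cite: BorceaBrandenLiggett2007, §4.3.1 Prop. 4.15 with Prop. 4.12] -/
theorem stochDom_cominorLaw (hA : A.PosSemidef) (hAB : (B - A).PosSemidef) : StochDom (cominorLaw B) (cominorLaw A) :=
  (BorceaBrandenLiggett_prop_4_15_second_srLe hA hAB).stochDom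

/-- Expectations of increasing functions: `E_{cominorLaw B} F ≤ E_{cominorLaw A} F`.
[cite: BorceaBrandenLiggett2007, §4.3.1 Prop. 4.15 with Prop. 4.12] -/
theorem ex_cominorLaw_le (hA : A.PosSemidef) (hAB : (B - A).PosSemidef) {F : Finset σ → ℝ} (hF : Monotone F) :
    ex (cominorLaw B) F ≤ ex (cominorLaw A) F :=
  (BorceaBrandenLiggett_prop_4_15_second hA hAB).ex_le_ex hF

end Prop415

end Literature.Probability.NegativeDependence

end
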